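import Literature.AlgebraicGeometry.Frobenioids.ArchimedeanFSMProofs
import HarnessLib

/-!
# Frobenioids II, Proposition 3.4 (ii) under condition (a): PROOF
# (abc-iut cell, layer L1, node `FrdII:Prop3.4(ii)`, chain LC-L1-2 — the condition-(a) half)

Mochizuki, *The geometry of Frobenioids II: poly-Frobenioids*, Kyushu J. Math. **62** (2008)
401–460, §3, Proposition 3.4 (ii) p. 30, proof pp. 30–31 [cite: MochizukiFrdII2008, Prop 3.4 (ii) p.30].
PROOF-ONLY companion of `ArchimedeanFSM.lean` (statements, seat abc-iut-L1-t6).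

> "(ii) Let `φ : A → B` be a monomorphism of `F` such that [at least] one of the following two
> conditions is satisfied: (a) `φ` projects to an isomorphism of `D₀`; (b) … Then `φ` projects to a
> monomorphism `φ_D` of `D`." Proof (p. 30): "let `α_D, β_D : C_D → A_D` … such that
> `φ_D ∘ α_D = φ_D ∘ β_D` … it suffices to show that `α_D = β_D` … I claim that there exist linear
> isometries `α₀, β₀ : C₀ → A₀` that lift `α_{D₀}, β_{D₀}` … and satisfy `φ₀ ∘ α₀ = φ₀ ∘ β₀`. Indeed,
> this follows immediately if `α_{D₀} = β_{D₀}` [which is the case whenever condition (a) is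
> satisfied], by taking `α₀ = β₀` to be a pull-back morphism … we conclude that there exist linear
> isometries `α, β : C → A` that simultaneously lift `α₀, β₀` and `α_D, β_D` … and satisfy
> `φ ∘ α = φ ∘ β`. Since `φ` is a monomorphism of `F`, we thus conclude that `α = β`, hence that
> `α_D = β_D`."

PROVED here, for `F = A, N, R`: the printed argument whenever `α_{D₀} = β_{D₀}` — the common lift
is the linear isometry from the pulled-back object (`C0.exists_lift`, file `ArchimedeanFSMProofs`)
— hence item (ii) under condition (a) (`A.propII_condA`, `N.propII_condA`, `R.propII_condA`,
assembled in `prop34_ii_condA`). The condition-(b) half (which needs Lemma 3.2 (ii) and the slit /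
isotropic-hull analysis of Ex. 3.3 (v)) is NOT proved in this file. Nothing is defined here; no
statement of the paper is strengthened; no side is taken on [IUTchIII] Cor. 3.12.
-/

namespace Literature.AlgebraicGeometry.Frobenioids

open CategoryTheory

namespace ArchFrd

universe v u

variable {D : Type u} [Category.{v} D] (π : D ⥤ D0)

/-- **Prop. 3.4 (ii), proof, in `C = C₀ ×_{D₀} D`** (p. 30, the case `α_{D₀} = β_{D₀}`): two arrows
`a, b : Z → X_D` of `D` with the same projection to `D₀` lift SIMULTANEOUSLY, from one object of `C`
over `Z`, to arrows of `C` into `X` with a common `C₀`-component (a linear isometry), and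
consequently `a = b` as soon as some arrow `f` out of `X` with `a ∘ f_D = b ∘ f_D` is left-cancellable
against such pairs. Formulated as: the two lifts `a', b'` exist with `a' ≫ f = b' ≫ f` for every `f`
with `a ≫ f_D = b ≫ f_D`, and `a = b` follows from `a' = b'`. [cite: MochizukiFrdII2008, Prop 3.4 (ii) p.30] -/
theorem C.exists_lift₂ (X : C π) {Z : D} (a b : Z ⟶ X.snd) (hab : π.map a = π.map b) :
    ∃ (Z' : C π) (a' b' : Z' ⟶ X), a'.fst = b'.fst ∧ (a' = b' → a = b) ∧
      (∀ ⦃Y : C π⦄ (f : X ⟶ Y), a ≫ f.snd = b ≫ f.snd → a' ≫ f = b' ≫ f) ∧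
      C0.degFr a'.fst = 1 ∧ C0.div a'.fst = 1 := by
  obtain ⟨R, hR, ψ₀, hb, hd, -, hiso⟩ := C0.exists_lift X.fst (π.map a ≫ X.iso.inv)
  let Z0 : C0 := ⟨π.obj Z, R, hR⟩
  let Z' : C π := ⟨Z0, Z, Iso.refl _⟩
  have hb' : (PreFrobenioid.baseFunctor C0.toElem).map ψ₀ = π.map a ≫ X.iso.inv := hb
  have wa : (PreFrobenioid.baseFunctor C0.toElem).map ψ₀ ≫ X.iso.hom = Z'.iso.hom ≫ π.map a :=
    ((Iso.eq_comp_inv X.iso).mp hb').trans (Category.id_comp _).symm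
  have wb : (PreFrobenioid.baseFunctor C0.toElem).map ψ₀ ≫ X.iso.hom = Z'.iso.hom ≫ π.map b :=
    wa.trans (by rw [hab])
  refine ⟨Z', ⟨ψ₀, a, wa⟩, ⟨ψ₀, b, wb⟩, rfl, fun h => congrArg CFP.Hom.snd h, fun Y f hf => ?_,
    hd, hiso⟩
  exact CFP.hom_ext rfl hf

/-- Two parallel arrows of `D` with the same composite with an arrow projecting to an isomorphism of
`D₀` have the same projection to `D₀` (condition (a): "`φ` projects to an isomorphism of `D₀`" forces
`α_{D₀} = β_{D₀}`, p. 30). [cite: MochizukiFrdII2008, Prop 3.4 (ii) p.30] -/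
theorem map_eq_of_isIso_map {Z XD YD : D} (a b : Z ⟶ XD) (φD : XD ⟶ YD) (hφ : IsIso (π.map φD))
    (h : a ≫ φD = b ≫ φD) : π.map a = π.map b := by
  haveI := hφ
  rw [← cancel_mono (π.map φD), ← Functor.map_comp, h, Functor.map_comp]

/-- **Proposition 3.4 (ii) under condition (a)**, for `F = A`: a monomorphism of the angular
Frobenioid that projects to an isomorphism of `D₀` projects to a monomorphism of `D`.
[cite: MochizukiFrdII2008, Prop 3.4 (ii) p.30] -/
theorem A.propII_condA ⦃X Y : A π⦄ (φ : X ⟶ Y) (hφ : Mono φ) (ha : (towerA π).CondA φ) :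
    Mono ((towerA π).toD.map φ) := by
  refine ⟨fun a b h => ?_⟩
  obtain ⟨Z', a', b', hfst, hab, hcomp, -, hdiv⟩ :=
    C.exists_lift₂ π X.obj a b (map_eq_of_isIso_map π a b _ ha h)
  have hdiv' : PreFrobenioid.Div C0.toElem a'.fst = 1 := hdiv
  have ha' : PreFrobenioid.isometricMorphisms (C.toElem π) a' := by
    change pull _ _ (PreFrobenioid.Div C0.toElem a'.fst) = 1
    rw [hdiv', map_one]
  have hb' : PreFrobenioid.isometricMorphisms (C.toElem π) b' := by
    change pull _ _ (PreFrobenioid.Div C0.toElem b'.fst) = 1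
    rw [← hfst, hdiv', map_one]
  have heq : (⟨a', ha'⟩ : (⟨Z'⟩ : A π) ⟶ X) ≫ φ = (⟨b', hb'⟩ : (⟨Z'⟩ : A π) ⟶ X) ≫ φ :=
    WideSubcategory.hom_ext _ (hcomp φ.hom h)
  haveI := hφ
  exact hab (congrArg InducedWideCategory.Hom.hom ((cancel_mono φ).mp heq))

/-- **Proposition 3.4 (ii) under condition (a)**, for `F = N`: a monomorphism of the non-rigidified
angloid that projects to an isomorphism of `D₀` projects to a monomorphism of `D`.
[cite: MochizukiFrdII2008, Prop 3.4 (ii) p.30] -/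
theorem N.propII_condA ⦃X Y : N π⦄ (φ : X ⟶ Y) (hφ : Mono φ) (ha : (towerN π).CondA φ) :
    Mono ((towerN π).toD.map φ) := by
  refine ⟨fun a b h => ?_⟩
  obtain ⟨Z', a', b', hfst, hab, hcomp, hdeg, hdiv⟩ :=
    C.exists_lift₂ π X.obj.obj a b (map_eq_of_isIso_map π a b _ ha h)
  have hdiv' : PreFrobenioid.Div C0.toElem a'.fst = 1 := hdiv
  have ha' : PreFrobenioid.isometricMorphisms (C.toElem π) a' := by
    change pull _ _ (PreFrobenioid.Div C0.toElem a'.fst) = 1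
    rw [hdiv', map_one]
  have hb' : PreFrobenioid.isometricMorphisms (C.toElem π) b' := by
    change pull _ _ (PreFrobenioid.Div C0.toElem b'.fst) = 1
    rw [← hfst, hdiv', map_one]
  have hla : PreFrobenioid.linearMorphisms (A.toElem π) (⟨a', ha'⟩ : (⟨Z'⟩ : A π) ⟶ X.obj) := hdeg
  have hlb : PreFrobenioid.linearMorphisms (A.toElem π) (⟨b', hb'⟩ : (⟨Z'⟩ : A π) ⟶ X.obj) := by
    change C0.degFr b'.fst = 1
    rw [← hfst]
    exact hdeg
  have heq : (⟨⟨a', ha'⟩, hla⟩ : (⟨⟨Z'⟩⟩ : N π) ⟶ X) ≫ φ =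
      (⟨⟨b', hb'⟩, hlb⟩ : (⟨⟨Z'⟩⟩ : N π) ⟶ X) ≫ φ :=
    WideSubcategory.hom_ext _ (WideSubcategory.hom_ext _ (hcomp φ.hom.hom h))
  haveI := hφ
  exact hab (congrArg (fun f => InducedWideCategory.Hom.hom (InducedWideCategory.Hom.hom f))
    ((cancel_mono φ).mp heq))

/-- **Proposition 3.4 (ii) under condition (a)**, for `F = R`: a monomorphism of the rigidified
angloid that projects to an isomorphism of `D₀` projects to a monomorphism of `D`.
[cite: MochizukiFrdII2008, Prop 3.4 (ii) p.30] -/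
theorem R.propII_condA ⦃X Y : R π⦄ (φ : X ⟶ Y) (hφ : Mono φ) (ha : (towerR π).CondA φ) :
    Mono ((towerR π).toD.map φ) := by
  refine ⟨fun a b h => ?_⟩
  have hab : π.map a = π.map b := map_eq_of_isIso_map π a b _ ha h
  obtain ⟨R', hR', ψ₀, hb, hd, -, hiso⟩ := C0.exists_lift X.fst.left.obj.obj (π.map a ≫ X.iso.inv)
  let g : (⟨⟨⟨_, R', hR'⟩⟩⟩ : N0) ⟶ X.fst.left := N0.homMk ψ₀ hiso hd
  let rZ : R0 := Over.mk (g ≫ X.fst.hom)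
  let gO : rZ ⟶ X.fst := Over.homMk g rfl
  let Z' : R π := ⟨rZ, _, Iso.refl _⟩
  have hb' : R0.toD0.map gO = π.map a ≫ X.iso.inv := hb
  have wa : R0.toD0.map gO ≫ X.iso.hom = Z'.iso.hom ≫ π.map a :=
    ((Iso.eq_comp_inv X.iso).mp hb').trans (Category.id_comp _).symm
  have wb : R0.toD0.map gO ≫ X.iso.hom = Z'.iso.hom ≫ π.map b := wa.trans (by rw [hab])
  have heq : (⟨gO, a, wa⟩ : Z' ⟶ X) ≫ φ = (⟨gO, b, wb⟩ : Z' ⟶ X) ≫ φ := CFP.hom_ext rfl h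
  haveI := hφ
  exact congrArg CFP.Hom.snd ((cancel_mono φ).mp heq)

/-- **Proposition 3.4 (ii) under condition (a)** PROVED for `F = A, N, R`: "Let `φ : A → B` be a
monomorphism of `F` such that (a) `φ` projects to an isomorphism of `D₀`. Then `φ` projects to a
monomorphism `φ_D` of `D`." (The condition-(b) half of item (ii) is not proved here.)
[cite: MochizukiFrdII2008, Prop 3.4 (ii) p.30] -/
theorem prop34_ii_condA :
    (∀ ⦃X Y : A π⦄ (φ : X ⟶ Y), Mono φ → (towerA π).CondA φ → Mono ((towerA π).toD.map φ)) ∧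
    (∀ ⦃X Y : N π⦄ (φ : X ⟶ Y), Mono φ → (towerN π).CondA φ → Mono ((towerN π).toD.map φ)) ∧
    (∀ ⦃X Y : R π⦄ (φ : X ⟶ Y), Mono φ → (towerR π).CondA φ → Mono ((towerR π).toD.map φ)) :=
  ⟨A.propII_condA π, N.propII_condA π, R.propII_condA π⟩

end ArchFrd

end Literature.AlgebraicGeometry.Frobenioids
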